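import Summits.CriticalPhenomena.PercolationContinuityZ3.Theorems.PercNearOneGluingAdditiveGluingThreeRelaysRegion
import Summits.CriticalPhenomena.PercolationContinuityZ3.Theorems.PercNearOneGluingNoHeavyLowerTailPureExchange
import HarnessLib

/-! # Crux `PercNearOneGluing.AdditiveGluing` (stmt-CriticalPhenomena-4576): three relays —
# the Lemma-3(i) split: the bad region reduced to an OR of two single-competitor bounds

Support file (`--supports stmt-CriticalPhenomena-4576`, deep seat r2).  No definitions, no named facts, no sorries.
Notation: `μ = prodBernoulli w`, relays `a₁ a₂ a₃` (distinct, `a₃` worst), target `b`, observer `o`, `E(o) = {o↔a₁}∪{o↔a₂}∪{o↔a₃}`,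
`L := μ(E(o), o↮b, a₃↔b)` (the additive inequality for three relays is `μ(E(o) ∖ o↔b) ≤ μ(a₃↮b)`, i.e. `L ≤ W + D` with
`W := μ(a₃↮b, o↔b, E(o))`, `D := μ(E(o)ᶜ, a₃↮b)`), and the single-competitor leftovers
`A₂ := μ(o↔a₂, o↮a₁, o↮b, a₃↔b)` ("o hangs on a₂ alone while b holds a₃"), `A₁` (swap 1 ↔ 2),
`Pob₂ := μ(o↔b, a₂↔b, a₁↮b, a₃↮b)` ("o and b captured by a₂ alone"), `Pob₁`.

**The split.** `L = μ(a₃↔b, a₁↔o, o↮b) + A₂`, and Kozma–Nitzan's Lemma 3(i) (landed `knLemma3i`) with the increasing event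
`Q = {a₁ ↔ o}` of the cluster of `a₁` and `τ₃ ≤ τ₁` gives `μ(a₃↔b, Q) ≤ μ(a₁↔b, Q)`, whence
`μ(a₃↔b, a₁↔o, o↮b) ≤ μ(a₁↔b, a₁↔o, a₃↮b) ≤ W − Pob₂`.  Hence (`threeRelays_eform_of_competitorBound`)
  **`A₂ ≤ Pob₂ + D ⟹ μ(E(o) ∖ o↔b) ≤ μ(a₃↮b)`**   (and symmetrically with `A₁ ≤ Pob₁ + D`, using `τ₃ ≤ τ₂`),
with NO region or badness hypothesis.  So the additive inequality for three relays follows from the **OR-lemma**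
  (OR)  `a₃` worst, `τ(o) < τ₃`, `m₁₂ < m₃`  ⟹  `A₂ ≤ Pob₂ + D ∨ A₁ ≤ Pob₁ + D`
(`additiveGluing_threeRelays_of_orLemma`: `o` good is trivial; the good region `m₃ ≤ m₁₂` is KN's Theorem 2, landed).
Numerics (deep seat r2, exact engine, item evidence STRUCTURAL-CHAIN.md / TERMINAL-NOGO.md): (OR) held in every bad-region instance
with `o` bad (≈1 600 random n ≤ 6, 11 adversarial annealing runs); each disjunct alone fails (the first iff `o` strongly prefers `a₂`,
the second iff `o` strongly prefers `a₁`); and (OR) is NOT derivable from 5-terminal BHK/Harris/Lemma-3 inequalities (an explicit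
row-feasible pseudo-measure violates it), so its proof must use the structure of `G ∖ o`.
[cite: KozmaNitzan2024, Lemma 3(i) (p. 6), Theorem 2 (§3.2, pp. 8–9)]
-/

namespace Summit.CriticalPhenomena.PercolationContinuityZ3.Theorems

open MeasureTheory Set Literature.Probability.LatticeModels Literature.Probability.Percolation

noncomputable section
open Classical

variable {n : ℕ}

/-- **The Lemma-3(i) exchange for the `a₁`-part of `L`**: if `τ₃ ≤ τ₁` then
`μ(a₃↔b, a₁↔o, o↮b) ≤ μ(a₁↔b, a₁↔o, a₃↮b)`. [cite: KozmaNitzan2024, Lemma 3(i) (p. 6)] -/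
theorem threeRelays_exchange_oa1 (w : Sym2 (Fin n) → unitInterval) (o b a₁ a₃ : Fin n)
    (hτ31 : (prodBernoulli w).real (openConn a₃ b) ≤ (prodBernoulli w).real (openConn a₁ b)) :
    (prodBernoulli w).real (openConn a₃ b ∩ openConn a₁ o ∩ (openConn o b)ᶜ) ≤
      (prodBernoulli w).real (openConn a₁ b ∩ openConn a₁ o ∩ (openConn a₃ b)ᶜ) := by
  have hm : ∀ s : Set (BondConfig (Fin n)), MeasurableSet s := fun _ => MeasurableSet.of_discrete
  have key := knLemma3i n w a₃ a₁ b (openConn a₁ o) 0 (pureExchange_Q_mono a₁ o) le_rfl (by simpa using hτ31)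
  simp only [zero_mul, add_zero] at key
  -- split both sides along `{o ↔ b}` resp. `{a₃ ↔ b}`; the removed parts coincide (`= {o ↔ a₁ ↔ b ↔ a₃}`)
  have h1 := measureReal_inter_add_sdiff (μ := prodBernoulli w) (s := openConn a₃ b ∩ openConn a₁ o) (hm (openConn o b))
  have h2 := measureReal_inter_add_sdiff (μ := prodBernoulli w) (s := openConn a₁ b ∩ openConn a₁ o) (hm (openConn a₃ b))
  have heq : (openConn a₃ b ∩ openConn a₁ o ∩ openConn o b : Set (BondConfig (Fin n))) =
      openConn a₁ b ∩ openConn a₁ o ∩ openConn a₃ b := by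
    ext ω
    simp only [Set.mem_inter_iff, knThm2_mem_openConn]
    constructor
    · rintro ⟨⟨h3b, h1o⟩, hob⟩
      exact ⟨⟨h1o.trans hob, h1o⟩, h3b⟩
    · rintro ⟨⟨h1b, h1o⟩, h3b⟩
      exact ⟨⟨h3b, h1o⟩, h1o.symm.trans h1b⟩
  rw [Set.sdiff_eq] at h1 h2
  rw [heq] at h1
  linarith

/-- The set-theoretic split `{E(o), o↮b, a₃↔b} = {a₃↔b, a₁↔o, o↮b} ⊔ {o↔a₂, o↮a₁, o↮b, a₃↔b}`. [folklore] -/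
theorem threeRelays_L_split (o b a₁ a₂ a₃ : Fin n) :
    ((openConn o a₁ ∪ openConn o a₂ ∪ openConn o a₃) ∩ (openConn o b)ᶜ ∩ openConn a₃ b : Set (BondConfig (Fin n))) =
      (openConn a₃ b ∩ openConn a₁ o ∩ (openConn o b)ᶜ) ∪
        (openConn o a₂ ∩ (openConn o a₁)ᶜ ∩ (openConn o b)ᶜ ∩ openConn a₃ b) := by
  ext ω
  simp only [Set.mem_inter_iff, Set.mem_union, Set.mem_compl_iff, knThm2_mem_openConn]
  constructor
  · rintro ⟨⟨hE, hob⟩, h3b⟩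
    by_cases h1 : (openGraph ω).Reachable o a₁
    · exact Or.inl ⟨⟨h3b, h1.symm⟩, hob⟩
    · rcases hE with (h | h) | h
      · exact absurd h h1
      · exact Or.inr ⟨⟨⟨h, h1⟩, hob⟩, h3b⟩
      · exact absurd (h.trans h3b) hob
  · rintro (⟨⟨h3b, h1o⟩, hob⟩ | ⟨⟨⟨h2, _⟩, hob⟩, h3b⟩)
    · exact ⟨⟨Or.inl (Or.inl h1o.symm), hob⟩, h3b⟩
    · exact ⟨⟨Or.inl (Or.inr h2), hob⟩, h3b⟩

/-- **E-form of the additive inequality for three relays from a single-competitor bound.**  If `τ₃ ≤ τ₁` and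
`A₂ ≤ Pob₂ + D`, i.e. `μ(o↔a₂, o↮a₁, o↮b, a₃↔b) ≤ μ(o↔b, a₂↔b, a₁↮b, a₃↮b) + μ(E(o)ᶜ, a₃↮b)`, then
`μ(E(o) ∖ o↔b) ≤ μ(a₃↮b)`.  (Lemma 3(i) handles the part of `L` where `o ↔ a₁`; no region or badness hypothesis.)
[cite: KozmaNitzan2024, Lemma 3(i) (p. 6)] -/
theorem threeRelays_eform_of_competitorBound (w : Sym2 (Fin n) → unitInterval) (o b a₁ a₂ a₃ : Fin n)
    (hτ31 : (prodBernoulli w).real (openConn a₃ b) ≤ (prodBernoulli w).real (openConn a₁ b))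
    (hY : (prodBernoulli w).real (openConn o a₂ ∩ (openConn o a₁)ᶜ ∩ (openConn o b)ᶜ ∩ openConn a₃ b) ≤
      (prodBernoulli w).real (openConn o b ∩ openConn a₂ b ∩ (openConn a₁ b)ᶜ ∩ (openConn a₃ b)ᶜ) +
        (prodBernoulli w).real
          ((openConn o a₁ ∪ openConn o a₂ ∪ openConn o a₃)ᶜ ∩ (openConn a₃ b)ᶜ : Set (BondConfig (Fin n)))) :
    (prodBernoulli w).real ((openConn o a₁ ∪ openConn o a₂ ∪ openConn o a₃) \ openConn o b) ≤
      (prodBernoulli w).real ((openConn a₃ b)ᶜ : Set (BondConfig (Fin n))) := by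
  have hm : ∀ s : Set (BondConfig (Fin n)), MeasurableSet s := fun _ => MeasurableSet.of_discrete
  set Eo : Set (BondConfig (Fin n)) := openConn o a₁ ∪ openConn o a₂ ∪ openConn o a₃ with hEo
  -- (1) `μ(E(o) ∖ ob) = L + μ(E(o), o↮b, a₃↮b)`
  have h1 := measureReal_inter_add_sdiff (μ := prodBernoulli w) (s := Eo \ openConn o b) (hm (openConn a₃ b))
  -- (2) `μ(a₃↮b) = μ(a₃↮b, E(o)) + D`,  `μ(a₃↮b, E(o)) = W + μ(a₃↮b, E(o), o↮b)`
  have h2 := measureReal_inter_add_sdiff (μ := prodBernoulli w) (s := ((openConn a₃ b)ᶜ : Set (BondConfig (Fin n)))) (hm Eo)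
  have h3 := measureReal_inter_add_sdiff (μ := prodBernoulli w) (s := ((openConn a₃ b)ᶜ : Set (BondConfig (Fin n))) ∩ Eo)
    (hm (openConn o b))
  have e1 : ((Eo \ openConn o b) ∩ openConn a₃ b : Set (BondConfig (Fin n))) = Eo ∩ (openConn o b)ᶜ ∩ openConn a₃ b := by
    ext ω; simp only [Set.mem_inter_iff, Set.mem_sdiff, Set.mem_compl_iff]
  have e2 : ((Eo \ openConn o b) \ openConn a₃ b : Set (BondConfig (Fin n))) = (((openConn a₃ b)ᶜ ∩ Eo) \ openConn o b) := by
    ext ω; simp only [Set.mem_inter_iff, Set.mem_sdiff, Set.mem_compl_iff]; tauto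
  have e3 : (((openConn a₃ b)ᶜ : Set (BondConfig (Fin n))) \ Eo) = Eoᶜ ∩ (openConn a₃ b)ᶜ := by
    ext ω; simp only [Set.mem_inter_iff, Set.mem_sdiff, Set.mem_compl_iff]; tauto
  rw [e1, e2] at h1
  rw [e3] at h2
  -- (3) the split of `L` and the exchange
  have hsplit : (prodBernoulli w).real (Eo ∩ (openConn o b)ᶜ ∩ openConn a₃ b) ≤
      (prodBernoulli w).real (openConn a₃ b ∩ openConn a₁ o ∩ (openConn o b)ᶜ) +
        (prodBernoulli w).real (openConn o a₂ ∩ (openConn o a₁)ᶜ ∩ (openConn o b)ᶜ ∩ openConn a₃ b) := by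
    rw [hEo, threeRelays_L_split]
    exact measureReal_union_le _ _
  have hex := threeRelays_exchange_oa1 w o b a₁ a₃ hτ31
  -- (4) `W ≥ μ(a₁↔b, a₁↔o, a₃↮b) + Pob₂` (disjoint sub-events of `{a₃↮b} ∩ E(o) ∩ {o↔b}`)
  have hdisj : Disjoint (openConn a₁ b ∩ openConn a₁ o ∩ (openConn a₃ b)ᶜ : Set (BondConfig (Fin n)))
      (openConn o b ∩ openConn a₂ b ∩ (openConn a₁ b)ᶜ ∩ (openConn a₃ b)ᶜ) := by
    rw [Set.disjoint_left]
    rintro ω ⟨⟨h1b, -⟩, -⟩ ⟨⟨⟨-, -⟩, hn1b⟩, -⟩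
    exact hn1b h1b
  have hsub : (openConn a₁ b ∩ openConn a₁ o ∩ (openConn a₃ b)ᶜ : Set (BondConfig (Fin n))) ∪
      (openConn o b ∩ openConn a₂ b ∩ (openConn a₁ b)ᶜ ∩ (openConn a₃ b)ᶜ) ⊆
      ((openConn a₃ b)ᶜ ∩ Eo) ∩ openConn o b := by
    rintro ω (⟨⟨h1b, h1o⟩, hn3⟩ | ⟨⟨⟨hob, h2b⟩, -⟩, hn3⟩)
    · refine ⟨⟨hn3, ?_⟩, ?_⟩
      · exact Or.inl (Or.inl (show (openGraph ω).Reachable o a₁ from SimpleGraph.Reachable.symm h1o))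
      · exact (SimpleGraph.Reachable.symm h1o).trans h1b
    · refine ⟨⟨hn3, ?_⟩, hob⟩
      exact Or.inl (Or.inr (show (openGraph ω).Reachable o a₂ from hob.trans (SimpleGraph.Reachable.symm h2b)))
  have hW : (prodBernoulli w).real (openConn a₁ b ∩ openConn a₁ o ∩ (openConn a₃ b)ᶜ) +
      (prodBernoulli w).real (openConn o b ∩ openConn a₂ b ∩ (openConn a₁ b)ᶜ ∩ (openConn a₃ b)ᶜ) ≤
      (prodBernoulli w).real (((openConn a₃ b)ᶜ ∩ Eo) ∩ openConn o b) := by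
    rw [← measureReal_union hdisj (hm _)]
    exact measureReal_mono hsub
  have hnn : 0 ≤ (prodBernoulli w).real ((((openConn a₃ b)ᶜ ∩ Eo) \ openConn o b) : Set (BondConfig (Fin n))) :=
    measureReal_nonneg
  linarith

/-- Swapping the first two relays in `E(o)`. [folklore] -/
theorem threeRelays_union_swap12 (o a₁ a₂ a₃ : Fin n) :
    (openConn o a₂ ∪ openConn o a₁ ∪ openConn o a₃ : Set (BondConfig (Fin n))) = openConn o a₁ ∪ openConn o a₂ ∪ openConn o a₃ := by
  ext ω; simp only [Set.mem_union]; tauto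

/-- **Additive gluing for three relays, reduced to the OR-lemma.**  If, whenever `a₃` is a worst relay, `o` is strictly less
reliable than `a₃` and `m₁₂ < m₃`, one of the two single-competitor bounds `A₂ ≤ Pob₂ + D`, `A₁ ≤ Pob₁ + D` holds, then for all
three distinct relays with `μ(a₃ ↔ b) ≥ 1 − t` and `a₃` worst: `μ(E(o) ∖ {o ↔ b}) ≤ t`.  Cases: `τ(o) ≥ τ₃` trivial;
`m₃ ≤ m₁₂` = Kozma–Nitzan's Theorem 2 (`knThm2_core`, landed `stub_bhkSets`, `stub_knLemma2`); otherwise the OR-lemma and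
`threeRelays_eform_of_competitorBound` (for `a₁`, or for `a₂` after swapping). [cite: KozmaNitzan2024, Theorem 2 (§3.2, pp. 8–9), Lemma 3(i) (p. 6)] -/
theorem additiveGluing_threeRelays_of_orLemma
    (hOR : ∀ (n : ℕ) (w : Sym2 (Fin n) → unitInterval) (o b a₁ a₂ a₃ : Fin n),
      a₁ ≠ a₂ → a₁ ≠ a₃ → a₂ ≠ a₃ →
      (prodBernoulli w).real (openConn a₃ b) ≤ (prodBernoulli w).real (openConn a₁ b) →
      (prodBernoulli w).real (openConn a₃ b) ≤ (prodBernoulli w).real (openConn a₂ b) →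
      (prodBernoulli w).real (openConn o b) < (prodBernoulli w).real (openConn a₃ b) →
      (prodBernoulli w).real ((openConn a₁ a₃)ᶜ ∩ (openConn a₂ a₃)ᶜ ∩ (openConn a₁ b ∩ openConn a₂ b)) <
        (prodBernoulli w).real ((openConn a₁ a₃)ᶜ ∩ (openConn a₂ a₃)ᶜ ∩ openConn a₃ b) →
      (prodBernoulli w).real (openConn o a₂ ∩ (openConn o a₁)ᶜ ∩ (openConn o b)ᶜ ∩ openConn a₃ b) ≤
          (prodBernoulli w).real (openConn o b ∩ openConn a₂ b ∩ (openConn a₁ b)ᶜ ∩ (openConn a₃ b)ᶜ) +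
            (prodBernoulli w).real
              ((openConn o a₁ ∪ openConn o a₂ ∪ openConn o a₃)ᶜ ∩ (openConn a₃ b)ᶜ : Set (BondConfig (Fin n))) ∨
        (prodBernoulli w).real (openConn o a₁ ∩ (openConn o a₂)ᶜ ∩ (openConn o b)ᶜ ∩ openConn a₃ b) ≤
          (prodBernoulli w).real (openConn o b ∩ openConn a₁ b ∩ (openConn a₂ b)ᶜ ∩ (openConn a₃ b)ᶜ) +
            (prodBernoulli w).real
              ((openConn o a₁ ∪ openConn o a₂ ∪ openConn o a₃)ᶜ ∩ (openConn a₃ b)ᶜ : Set (BondConfig (Fin n)))) :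
    ∀ (n : ℕ) (w : Sym2 (Fin n) → unitInterval) (o b a₁ a₂ a₃ : Fin n) (t : ℝ),
      a₁ ≠ a₂ → a₁ ≠ a₃ → a₂ ≠ a₃ →
      1 - t ≤ (prodBernoulli w).real (openConn a₃ b) →
      (prodBernoulli w).real (openConn a₃ b) ≤ (prodBernoulli w).real (openConn a₁ b) →
      (prodBernoulli w).real (openConn a₃ b) ≤ (prodBernoulli w).real (openConn a₂ b) →
      (prodBernoulli w).real ((openConn o a₁ ∪ openConn o a₂ ∪ openConn o a₃) \ openConn o b) ≤ t := by
  intro n w o b a₁ a₂ a₃ t h12 h13 h23 hτ3 hτ31 hτ32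
  have hm : ∀ s : Set (BondConfig (Fin n)), MeasurableSet s := fun _ => MeasurableSet.of_discrete
  have hc3 : (prodBernoulli w).real ((openConn a₃ b)ᶜ : Set (BondConfig (Fin n))) =
      1 - (prodBernoulli w).real (openConn a₃ b : Set (BondConfig (Fin n))) := probReal_compl_eq_one_sub (hm _)
  suffices hE : (prodBernoulli w).real ((openConn o a₁ ∪ openConn o a₂ ∪ openConn o a₃) \ openConn o b) ≤
      (prodBernoulli w).real ((openConn a₃ b)ᶜ : Set (BondConfig (Fin n))) by linarith
  by_cases hob : (prodBernoulli w).real (openConn a₃ b) ≤ (prodBernoulli w).real (openConn o b)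
  · have hco : (prodBernoulli w).real ((openConn o b)ᶜ : Set (BondConfig (Fin n))) =
        1 - (prodBernoulli w).real (openConn o b : Set (BondConfig (Fin n))) := probReal_compl_eq_one_sub (hm _)
    have hsub : (prodBernoulli w).real ((openConn o a₁ ∪ openConn o a₂ ∪ openConn o a₃) \ openConn o b) ≤
        (prodBernoulli w).real ((openConn o b)ᶜ : Set (BondConfig (Fin n))) :=
      measureReal_mono (fun ω hω => hω.2)
    linarith
  · push Not at hob
    by_cases hgood : (prodBernoulli w).real (openConn b a₃ ∩ (openConn b a₁)ᶜ ∩ (openConn b a₂)ᶜ) ≤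
        (prodBernoulli w).real (openConn b a₁ ∩ openConn b a₂ ∩ (openConn b a₃)ᶜ)
    · have hX := knThm2_core stub_bhkSets.1 stub_bhkSets.2 (stub_knLemma2 stub_bhkSets) w o b a₁ a₂ a₃
        h12 h13 h23 hτ31 hτ32 hgood
      have h1 := measureReal_inter_add_sdiff (μ := prodBernoulli w)
        (s := openConn o a₁ ∪ openConn o a₂ ∪ openConn o a₃) (hm (openConn o b))
      have h2 := measureReal_inter_add_sdiff (μ := prodBernoulli w)
        (s := openConn o a₁ ∪ openConn o a₂ ∪ openConn o a₃) (hm (openConn a₃ b))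
      have h3 : (prodBernoulli w).real ((openConn o a₁ ∪ openConn o a₂ ∪ openConn o a₃) \ openConn a₃ b) ≤
          (prodBernoulli w).real ((openConn a₃ b)ᶜ : Set (BondConfig (Fin n))) :=
        measureReal_mono fun ω hω => hω.2
      linarith
    · push Not at hgood
      rw [knThm2_m3, knThm2_m12] at hgood
      rcases hOR n w o b a₁ a₂ a₃ h12 h13 h23 hτ31 hτ32 hob hgood with hY | hY'
      · exact threeRelays_eform_of_competitorBound w o b a₁ a₂ a₃ hτ31 hY
      · have h := threeRelays_eform_of_competitorBound w o b a₂ a₁ a₃ hτ32 (by rwa [threeRelays_union_swap12])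
        rwa [threeRelays_union_swap12] at h

end

end Summit.CriticalPhenomena.PercolationContinuityZ3.Theorems
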